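import Mathlib
import Literature.NumberTheory.LFunctions.Zhang2022.Section12Eq128Coefficients
import Literature.NumberTheory.LFunctions.Zhang2022.Section11WindowSj
import Literature.NumberTheory.LFunctions.Zhang2022.Section11SjTrueSizeBound
import Literature.NumberTheory.LFunctions.Zhang2022.Section12Eq128OfSjDual
import HarnessLib

/-!
# Zhang (2022) §12 (12.8): the window estimate `hS′` reduced to its SHARP CORE `S_j(𝐬̄,𝐬) = o(α𝔞)`

Topic `Literature/NumberTheory/LFunctions/Zhang2022` (Landau–Siegel audit tree; verdict-neutral).
Y. Zhang, *Discrete mean estimates and the Landau–Siegel zero*, arXiv:2211.02515v1 (2022)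
[Zhang2022LandauSiegel], §12 p. 67 — **an unrefereed manuscript under adjudication; nothing here
asserts or denies its Theorems 1–2.** THEOREMS ONLY; 0 definitions, 0 facts (ZHANG-L lane; leaf hXi
`Typed.Sec12A.Xi15Hbar16` / binder `Eq128`; row G-d42-3 (ii)).

After `eq128_of_sjDual_small` (tree), (12.8) rests on `hS′`: `S_j(𝐜̄,𝐜) = o(α𝔞)` for the
dual-side coefficient difference `𝐜`. By `Section12Eq128Coefficients`, `𝐜 = 𝐛 + 𝐞 + 𝐬`: the bulk
`𝐛` (`≤ C e^{−c𝓛¹⁰}`), the edge remainder `𝐞` (`≤ C𝓛⁻¹⁹`, on the two `η`-windows at `P″₁`, `P″₂`)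
and the SHARP part `𝐬 = (0.004/0.504)χ(n)(n/P″₁)^{β₆}(g(P″₂/n) − 1_{n<P″₂})·1_{[P″₂η₋,P″₂η₊)}`.
`S_j` is bilinear (`Sj_add_left/right`), and eight of the nine pieces of `S_j(𝐜̄,𝐜)` are small
by the two §11 engines of the tree, used BY NAME:

* any piece containing `𝐛`: the true-size bound `XiZeroMajorant.norm_Sj_le_of_bounds`
  (`≤ C_S B₁B₂𝓛²⁷`, here `≤ C e^{−c𝓛¹⁰}𝓛²⁷`);
* `𝐞×𝐞`, `𝐞×𝐬`, `𝐬×𝐞`: the window bound `WindowSj.norm_Sj_window_le` with the four centres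
  `P″₁η^{±½}, P″₂η^{±½}` (`η = e^{𝓛⁻¹⁰}`), giving `≤ 16·C·C_e·𝓛⁻¹⁹⁺⁸ = O(𝓛⁻¹¹)`.

Result `sjDual_small_of_sharpCore`: **`hS′` follows from its sharp core
`∀ε>0`, eventually under (A), `‖S_j(𝐬̄,𝐬)‖ ≤ εα𝔞`** — the `S_j`-form of ONE Gaussian window of
logarithmic width `𝓛⁻¹⁵` at `P″₂` with coefficients of size `≈ 4·10⁻³` (the smooth step `g` of the
dual sum against the sharp cut-off of `H̄₁₆`), a pure width-sensitive majorant problem (no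
character cancellation is available on so short a window). Conversely nothing is lost: the core is
one of the nine pieces.

## References

* Y. Zhang, arXiv:2211.02515v1 (2022), §12 (12.8) p. 67; §7 Prop. 7.1 (`S_j`); §11 p. 64.
  [cite: Zhang2022LandauSiegel, §12 (12.8) p.67]
-/

noncomputable section

open Complex Real ComplexConjugate

namespace Literature.NumberTheory.LFunctions.Zhang2022.Typed.Sec12A

open Skeleton

/-! ## §1. Bilinearity of `S_j` -/

section Bilinear

variable (c' : ℝ) (D : ℕ) (j : ℕ)

/-- `S_j` is additive in its first argument. [cite: Zhang2022LandauSiegel, §7 Prop. 7.1 p.33] -/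
theorem Sj_add_left (a b v : ℕ → ℂ) :
    Sj c' D j (fun n => a n + b n) v = Sj c' D j a v + Sj c' D j b v := by
  rw [Sj, Sj, Sj, ← Finset.sum_add_distrib]
  refine Finset.sum_congr rfl fun d _ => ?_
  rw [← Finset.sum_add_distrib]
  refine Finset.sum_congr rfl fun r _ => ?_
  have : ∑ m ∈ Finset.Ico 1 (Nsupp D), (a (d * r * m) + b (d * r * m)) / (m : ℂ) ^ (1 - betaJ c' D j) =
      (∑ m ∈ Finset.Ico 1 (Nsupp D), a (d * r * m) / (m : ℂ) ^ (1 - betaJ c' D j)) +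
        ∑ m ∈ Finset.Ico 1 (Nsupp D), b (d * r * m) / (m : ℂ) ^ (1 - betaJ c' D j) := by
    rw [← Finset.sum_add_distrib]
    exact Finset.sum_congr rfl fun m _ => by ring
  rw [this]; ring

/-- `S_j` is additive in its second argument. [cite: Zhang2022LandauSiegel, §7 Prop. 7.1 p.33] -/
theorem Sj_add_right (u a b : ℕ → ℂ) :
    Sj c' D j u (fun n => a n + b n) = Sj c' D j u a + Sj c' D j u b := by
  rw [Sj, Sj, Sj, ← Finset.sum_add_distrib]
  refine Finset.sum_congr rfl fun d _ => ?_
  rw [← Finset.sum_add_distrib]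
  refine Finset.sum_congr rfl fun r _ => ?_
  have : ∑ n ∈ Finset.Ico 1 (Nsupp D), (a (d * r * n) + b (d * r * n)) * xiZero c' D j n d r / (n : ℂ) =
      (∑ n ∈ Finset.Ico 1 (Nsupp D), a (d * r * n) * xiZero c' D j n d r / (n : ℂ)) +
        ∑ n ∈ Finset.Ico 1 (Nsupp D), b (d * r * n) * xiZero c' D j n d r / (n : ℂ) := by
    rw [← Finset.sum_add_distrib]
    exact Finset.sum_congr rfl fun n _ => by ring
  rw [this]; ring

/-- The nine-piece expansion of `S_j(u₁+u₂+u₃, v₁+v₂+v₃)`. [cite: Zhang2022LandauSiegel, §7 Prop. 7.1 p.33] -/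
theorem Sj_add₃ (u₁ u₂ u₃ v₁ v₂ v₃ : ℕ → ℂ) :
    Sj c' D j (fun n => u₁ n + u₂ n + u₃ n) (fun n => v₁ n + v₂ n + v₃ n) =
      (Sj c' D j u₁ v₁ + Sj c' D j u₁ v₂ + Sj c' D j u₁ v₃) +
      (Sj c' D j u₂ v₁ + Sj c' D j u₂ v₂ + Sj c' D j u₂ v₃) +
      (Sj c' D j u₃ v₁ + Sj c' D j u₃ v₂ + Sj c' D j u₃ v₃) := by
  have eL : (fun n => u₁ n + u₂ n + u₃ n) = fun n => (fun n => u₁ n + u₂ n) n + u₃ n := rfl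
  have eR : (fun n => v₁ n + v₂ n + v₃ n) = fun n => (fun n => v₁ n + v₂ n) n + v₃ n := rfl
  rw [eL, Sj_add_left, Sj_add_left, eR, Sj_add_right, Sj_add_right, Sj_add_right, Sj_add_right,
    Sj_add_right, Sj_add_right]

end Bilinear

/-! ## §2. Sizes -/

/-- For `D ≥ ⌈e^M⌉`, `𝓛 = log D ≥ M`. [cite: Zhang2022LandauSiegel, §2 p.4] -/
private theorem le_ell_of_ceil_exp_le'' {M : ℝ} {D : ℕ} (hD : ⌈Real.exp M⌉₊ ≤ D) : M ≤ ell D := by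
  have h : Real.exp M ≤ D := le_trans (Nat.le_ceil _) (by exact_mod_cast hD)
  exact (Real.le_log_iff_exp_le (lt_of_lt_of_le (Real.exp_pos _) h)).mpr h

/-- `e^{−y}·y⁴ ≤ 24` for `y ≥ 0`. [folklore] -/
private theorem exp_neg_mul_pow_four_le {y : ℝ} (hy : 0 ≤ y) : Real.exp (-y) * y ^ 4 ≤ 24 := by
  have h := Real.pow_div_factorial_le_exp y hy 4
  have h4 : ((4 : ℕ).factorial : ℝ) = 24 := by norm_num [Nat.factorial]
  rw [h4, div_le_iff₀ (by norm_num : (0 : ℝ) < 24)] at h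
  have h2 : Real.exp (-y) * Real.exp y = 1 := by rw [← Real.exp_add]; simp
  nlinarith [Real.exp_pos (-y), Real.exp_pos y]

/-- `η^a·η^b = η^{a+b}` for the scale factors `etaPM D a = e^{a𝓛⁻¹⁰}`. [cite: Zhang2022LandauSiegel, §11 p.63] -/
theorem etaPM_mul (D : ℕ) (a b : ℝ) : etaPM D a * etaPM D b = etaPM D (a + b) := by
  rw [etaPM, etaPM, etaPM, ← Real.exp_add]; ring_nf

/-- `etaPM D a > 0`. [cite: Zhang2022LandauSiegel, §11 p.63] -/
theorem etaPM_pos (D : ℕ) (a : ℝ) : 0 < etaPM D a := Real.exp_pos _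

/-- Strict monotonicity of `a ↦ etaPM D a` for `𝓛 > 0`. [cite: Zhang2022LandauSiegel, §11 p.63] -/
theorem etaPM_lt_etaPM {D : ℕ} (hℓ : 0 < ell D) {a b : ℝ} (hab : a < b) : etaPM D a < etaPM D b := by
  rw [etaPM, etaPM, Real.exp_lt_exp]
  exact mul_lt_mul_of_pos_right hab (inv_pos.mpr (pow_pos hℓ 10))

section Pieces

variable {D : ℕ} (χ : DirichletCharacter ℂ D)

/-- The half-open edge windows lie inside the four open `η`-windows with centres
`P″₁η^{±½}`, `P″₂η^{±½}`: if `xη₋ < n ≤ xη₊` or `xη₋ ≤ n < xη₊` (`x ∈ {P″₁, P″₂}`) then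
`yη₋ < n < yη₊` for `y = xη^{−½}` or `y = xη^{½}`. [cite: Zhang2022LandauSiegel, §12 p.67] -/
theorem mem_cover_of_edge (hℓ : 0 < ell D) {x : ℝ} (hx : 0 < x) {t : ℝ}
    (h : x * etaPM D (-1) ≤ t ∧ t ≤ x * etaPM D 1) :
    (x * etaPM D (-1 / 2) * etaPM D (-1) < t ∧ t < x * etaPM D (-1 / 2) * etaPM D 1) ∨
      (x * etaPM D (1 / 2) * etaPM D (-1) < t ∧ t < x * etaPM D (1 / 2) * etaPM D 1) := by
  rcases lt_or_ge t (x * etaPM D (1 / 2)) with ht | ht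
  · left
    refine ⟨?_, ?_⟩
    · rw [mul_assoc, etaPM_mul]
      have : x * etaPM D (-1 / 2 + -1) < x * etaPM D (-1) :=
        mul_lt_mul_of_pos_left (etaPM_lt_etaPM hℓ (by norm_num)) hx
      linarith [h.1]
    · rw [mul_assoc, etaPM_mul]; norm_num; exact ht
  · right
    refine ⟨?_, ?_⟩
    · rw [mul_assoc, etaPM_mul]
      have : x * etaPM D (1 / 2 + -1) < x * etaPM D (1 / 2) :=
        mul_lt_mul_of_pos_left (etaPM_lt_etaPM hℓ (by norm_num)) hx
      linarith
    · rw [mul_assoc, etaPM_mul]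
      have : x * etaPM D 1 < x * etaPM D (1 / 2 + 1) :=
        mul_lt_mul_of_pos_left (etaPM_lt_etaPM hℓ (by norm_num)) hx
      linarith [h.2]

end Pieces

/-! ## §3. The reduction of `hS′` to the sharp core -/

section Reduction

/-- **`hS′` from its sharp core.** If, for every `ε > 0`, eventually under (A),
`‖S_j(𝐬̄,𝐬)‖ ≤ ε·α·𝔞` (`j = 1,2,3`) for the sharp part
`s(n) = (0.004/0.504)χ(n)(n/P″₁)^{β₆}(g(P″₂/n) − 1_{n<P″₂})·1_{P″₂η₋≤n<P″₂η₊}`, then the window estimate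
`hS′` of `eq128_of_sj_small` / `eq128_of_sjDual_small` holds: `‖S_j(𝐜̄,𝐜)‖ ≤ ε·α·𝔞` eventually —
the other eight pieces of the bilinear expansion along `𝐜 = 𝐛 + 𝐞 + 𝐬` are `o(α𝔞)` by the tree's
true-size bound (`XiZeroMajorant.norm_Sj_le_of_bounds`) and window bound (`WindowSj.norm_Sj_window_le`).
[cite: Zhang2022LandauSiegel, §12 (12.8) p.67; §11 p.64] -/
theorem sjDual_small_of_sharpCore (c' : ℝ)
    (hcore : ∀ ε : ℝ, 0 < ε → ForAllLarge fun D _ χ => AssumptionA D χ →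
      ∀ j ∈ ({1, 2, 3} : Finset ℕ),
        ‖Sj c' D j (fun n : ℕ => conj (if P2pp D * etaPM D (-1) ≤ n ∧ (n : ℝ) < P2pp D * etaPM D 1 then
          ((0.004 / 0.504 : ℝ) : ℂ) * χ (n : ZMod D) * (((n : ℝ) / P1pp D : ℝ) : ℂ) ^ beta6 D *
            ((gW D (P2pp D / n) - (if (n : ℝ) < P2pp D then 1 else 0) : ℝ) : ℂ)
        else 0)) (fun n : ℕ => (if P2pp D * etaPM D (-1) ≤ n ∧ (n : ℝ) < P2pp D * etaPM D 1 then
          ((0.004 / 0.504 : ℝ) : ℂ) * χ (n : ZMod D) * (((n : ℝ) / P1pp D : ℝ) : ℂ) ^ beta6 D *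
            ((gW D (P2pp D / n) - (if (n : ℝ) < P2pp D then 1 else 0) : ℝ) : ℂ)
        else 0))‖ ≤ ε * alpha D * frakA χ) :
    ∀ ε : ℝ, 0 < ε → ForAllLarge fun D _ χ => AssumptionA D χ →
      ∀ j ∈ ({1, 2, 3} : Finset ℕ),
        ‖Sj c' D j
            (fun n : ℕ => conj ((if n ∈ ((Finset.Ico 1 ⌈P2pp D * etaPM D 1⌉₊).filter
          (fun n : ℕ => P1pp D * etaPM D (-1) < n ∧ (n : ℝ) < P2pp D * etaPM D 1)) then
          χ (n : ZMod D) * (((n : ℝ) / P1pp D : ℝ) : ℂ) ^ beta6 D * ((dualInt D n / 0.504 : ℝ) : ℂ)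
        else 0) -
        (if n ∈ ((Finset.Ico 1 ⌈P2pp D⌉₊).filter (fun n : ℕ => P1pp D < n ∧ (n : ℝ) < P2pp D)) then
          χ (n : ZMod D) * (((n : ℝ) / P1pp D : ℝ) : ℂ) ^ beta6 D *
            ((Real.log ((n : ℝ) / P1pp D) / Real.log (Skeleton.P1 D) : ℝ) : ℂ)
        else 0)))
            (fun n : ℕ => ((if n ∈ ((Finset.Ico 1 ⌈P2pp D * etaPM D 1⌉₊).filter
          (fun n : ℕ => P1pp D * etaPM D (-1) < n ∧ (n : ℝ) < P2pp D * etaPM D 1)) then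
          χ (n : ZMod D) * (((n : ℝ) / P1pp D : ℝ) : ℂ) ^ beta6 D * ((dualInt D n / 0.504 : ℝ) : ℂ)
        else 0) -
        (if n ∈ ((Finset.Ico 1 ⌈P2pp D⌉₊).filter (fun n : ℕ => P1pp D < n ∧ (n : ℝ) < P2pp D)) then
          χ (n : ZMod D) * (((n : ℝ) / P1pp D : ℝ) : ℂ) ^ beta6 D *
            ((Real.log ((n : ℝ) / P1pp D) / Real.log (Skeleton.P1 D) : ℝ) : ℂ)
        else 0)))‖ ≤
          ε * alpha D * frakA χ := by
  intro ε hε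
  obtain ⟨a₀, ha₀, hA⟩ := frakALowerBound_holds
  obtain ⟨cb, hcb, Cb, hbulk⟩ := norm_cSeq_bulk_le
  obtain ⟨Ce, hedge⟩ := norm_cSeq_sub_sharp_le
  obtain ⟨CW, hCW0, hW⟩ := WindowSj.norm_Sj_window_le
  obtain ⟨DW, hWD⟩ := hW c'
  have hε9 : 0 < ε / 9 := by positivity
  obtain ⟨D₀, h⟩ := (((hcore (ε / 9) hε9).and hA).and hbulk).and hedge
  -- the true-size constant
  set CS : ℝ := 4 * Real.exp (4 + LogEulerProduct.tailConst 0) *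
      Real.exp (16 + 7 * LogEulerProduct.tailConst 0) *
      Real.exp (28 + 14 * LogEulerProduct.tailConst 0) *
      (3 * Real.exp (4 + 1134 * π + (12 + 56 * LogEulerProduct.tailConst 3) +
        7 * (2 + LogEulerProduct.tailConst 3) * LogEulerProduct.tailConst 4)) with hCS
  have hCS0 : 0 < CS := by positivity
  set Bstar : ℝ := max 1 |Cb| with hBstar
  have hBstar1 : 1 ≤ Bstar := le_max_left _ _
  have hBstar0 : 0 < Bstar := by positivity
  -- thresholds
  set M₁ : ℝ := 216 * CS * Bstar * |Cb| / (cb ^ 4 * ε * π * a₀) with hM₁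
  set M₂ : ℝ := 144 * CW * |Ce| / (ε * π * a₀) with hM₂
  set M : ℝ := max (max (max M₁ M₂) (|Ce| + 1)) 4 with hMdef
  have hM4 : (4 : ℝ) ≤ M := le_max_right _ _
  refine ⟨max (max (max D₀ DW) ⌈Real.exp (5 * |c'| * π + 3)⌉₊) ⌈Real.exp M⌉₊,
    fun D _ χ hD hq hp hAss j hj => ?_⟩
  have hD₀ : D₀ ≤ D := le_trans (le_trans (le_trans (le_max_left _ _) (le_max_left _ _)) (le_max_left _ _)) hD
  have hDW : DW ≤ D := le_trans (le_trans (le_trans (le_max_right _ _) (le_max_left _ _)) (le_max_left _ _)) hD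
  have hDT : ⌈Real.exp (5 * |c'| * π + 3)⌉₊ ≤ D := le_trans (le_trans (le_max_right _ _) (le_max_left _ _)) hD
  have hMℓ : M ≤ ell D := le_ell_of_ceil_exp_le'' (le_trans (le_max_right _ _) hD)
  have hℓ4 : 4 ≤ ell D := le_trans hM4 hMℓ
  have hℓ : 0 < ell D := by linarith
  have hℓ1 : 1 ≤ ell D := by linarith
  have hℓ2 : 2 ≤ ell D := by linarith
  have hlog3 : 3 ≤ Real.log D := by rw [← ell]; linarith
  have hD1 : 1 ≤ Real.log D := by linarith
  have hM₁ℓ : M₁ ≤ ell D := le_trans (le_trans (le_trans (le_max_left _ _) (le_max_left _ _)) (le_max_left _ _)) hMℓ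
  have hM₂ℓ : M₂ ≤ ell D := le_trans (le_trans (le_trans (le_max_right _ _) (le_max_left _ _)) (le_max_left _ _)) hMℓ
  have hCeℓ : |Ce| + 1 ≤ ell D := le_trans (le_trans (le_max_right _ _) (le_max_left _ _)) hMℓ
  obtain ⟨⟨⟨hcore', hA'⟩, hbulk'⟩, hedge'⟩ := h D χ hD₀ hq hp
  have ha : a₀ ≤ frakA χ := hA' hAss
  have hfa : 0 ≤ frakA χ := le_trans ha₀.le ha
  have hα : alpha D = π / ell D ^ 9 := by rw [alpha, bigP, Real.log_exp]
  have hα0 : 0 < alpha D := by rw [hα]; positivity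
  obtain ⟨hη1, hη2, hη3, hη4, hη5⟩ := edge_sizes hℓ2
  have hP1pp := Sec12D.P1pp_pos hD1
  have hP2pp := Sec12D.P2pp_pos hD1
  have hPP : P2pp D = bigP D ^ (0.004 : ℝ) * P1pp D := by
    have := Sec12D.P2pp_div_P1pp hD1
    rw [div_eq_iff hP1pp.ne'] at this; exact this
  have hord1 : P1pp D * etaPM D 1 < P2pp D * etaPM D (-1) := by
    have h1 : etaPM D 1 < bigP D ^ (0.004 : ℝ) * etaPM D (-1) :=
      lt_trans (lt_mul_of_one_lt_left hη1 hη4) hη5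
    calc P1pp D * etaPM D 1 < P1pp D * (bigP D ^ (0.004 : ℝ) * etaPM D (-1)) :=
          mul_lt_mul_of_pos_left h1 hP1pp
      _ = P2pp D * etaPM D (-1) := by rw [hPP]; ring
  -- the three pieces, as opaque functions with pointwise equations
  obtain ⟨c, hcdef⟩ : ∃ f : ℕ → ℂ, ∀ n : ℕ, f n = ((if n ∈ ((Finset.Ico 1 ⌈P2pp D * etaPM D 1⌉₊).filter
          (fun n : ℕ => P1pp D * etaPM D (-1) < n ∧ (n : ℝ) < P2pp D * etaPM D 1)) then
          χ (n : ZMod D) * (((n : ℝ) / P1pp D : ℝ) : ℂ) ^ beta6 D * ((dualInt D n / 0.504 : ℝ) : ℂ)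
        else 0) -
        (if n ∈ ((Finset.Ico 1 ⌈P2pp D⌉₊).filter (fun n : ℕ => P1pp D < n ∧ (n : ℝ) < P2pp D)) then
          χ (n : ZMod D) * (((n : ℝ) / P1pp D : ℝ) : ℂ) ^ beta6 D *
            ((Real.log ((n : ℝ) / P1pp D) / Real.log (Skeleton.P1 D) : ℝ) : ℂ)
        else 0)) := ⟨_, fun n => rfl⟩
  obtain ⟨sh, hshdef⟩ : ∃ f : ℕ → ℂ, ∀ n : ℕ, f n = (if P2pp D * etaPM D (-1) ≤ n ∧ (n : ℝ) < P2pp D * etaPM D 1 then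
          ((0.004 / 0.504 : ℝ) : ℂ) * χ (n : ZMod D) * (((n : ℝ) / P1pp D : ℝ) : ℂ) ^ beta6 D *
            ((gW D (P2pp D / n) - (if (n : ℝ) < P2pp D then 1 else 0) : ℝ) : ℂ)
        else 0) := ⟨_, fun n => rfl⟩
  obtain ⟨b, hbdef⟩ : ∃ f : ℕ → ℂ, ∀ n : ℕ, f n =
      if P1pp D * etaPM D 1 < n ∧ (n : ℝ) < P2pp D * etaPM D (-1) then c n else 0 := ⟨_, fun n => rfl⟩
  obtain ⟨e, hedef⟩ : ∃ f : ℕ → ℂ, ∀ n : ℕ, f n = c n - b n - sh n := ⟨_, fun n => rfl⟩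
  have ec : (fun n : ℕ => ((if n ∈ ((Finset.Ico 1 ⌈P2pp D * etaPM D 1⌉₊).filter
          (fun n : ℕ => P1pp D * etaPM D (-1) < n ∧ (n : ℝ) < P2pp D * etaPM D 1)) then
          χ (n : ZMod D) * (((n : ℝ) / P1pp D : ℝ) : ℂ) ^ beta6 D * ((dualInt D n / 0.504 : ℝ) : ℂ)
        else 0) -
        (if n ∈ ((Finset.Ico 1 ⌈P2pp D⌉₊).filter (fun n : ℕ => P1pp D < n ∧ (n : ℝ) < P2pp D)) then
          χ (n : ZMod D) * (((n : ℝ) / P1pp D : ℝ) : ℂ) ^ beta6 D *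
            ((Real.log ((n : ℝ) / P1pp D) / Real.log (Skeleton.P1 D) : ℝ) : ℂ)
        else 0))) = c := funext fun n => (hcdef n).symm
  have ecc : (fun n : ℕ => conj ((if n ∈ ((Finset.Ico 1 ⌈P2pp D * etaPM D 1⌉₊).filter
          (fun n : ℕ => P1pp D * etaPM D (-1) < n ∧ (n : ℝ) < P2pp D * etaPM D 1)) then
          χ (n : ZMod D) * (((n : ℝ) / P1pp D : ℝ) : ℂ) ^ beta6 D * ((dualInt D n / 0.504 : ℝ) : ℂ)
        else 0) -
        (if n ∈ ((Finset.Ico 1 ⌈P2pp D⌉₊).filter (fun n : ℕ => P1pp D < n ∧ (n : ℝ) < P2pp D)) then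
          χ (n : ZMod D) * (((n : ℝ) / P1pp D : ℝ) : ℂ) ^ beta6 D *
            ((Real.log ((n : ℝ) / P1pp D) / Real.log (Skeleton.P1 D) : ℝ) : ℂ)
        else 0))) = fun n => conj (c n) := funext fun n => by rw [hcdef]
  have esh : (fun n : ℕ => (if P2pp D * etaPM D (-1) ≤ n ∧ (n : ℝ) < P2pp D * etaPM D 1 then
          ((0.004 / 0.504 : ℝ) : ℂ) * χ (n : ZMod D) * (((n : ℝ) / P1pp D : ℝ) : ℂ) ^ beta6 D *
            ((gW D (P2pp D / n) - (if (n : ℝ) < P2pp D then 1 else 0) : ℝ) : ℂ)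
        else 0)) = sh := funext fun n => (hshdef n).symm
  have eshc : (fun n : ℕ => conj (if P2pp D * etaPM D (-1) ≤ n ∧ (n : ℝ) < P2pp D * etaPM D 1 then
          ((0.004 / 0.504 : ℝ) : ℂ) * χ (n : ZMod D) * (((n : ℝ) / P1pp D : ℝ) : ℂ) ^ beta6 D *
            ((gW D (P2pp D / n) - (if (n : ℝ) < P2pp D then 1 else 0) : ℝ) : ℂ)
        else 0)) = fun n => conj (sh n) := funext fun n => by rw [hshdef]
  rw [ec, ecc]
  rw [esh, eshc] at hcore'
  rw [ec] at hbulk' hedge'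
  have hedge'' : ∀ n : ℕ, ‖c n - sh n‖ ≤ Ce * (ell D ^ 19)⁻¹ := by
    intro n; rw [hshdef n]; exact hedge' n
  have hsplit : c = fun n => b n + e n + sh n := by
    funext n; rw [hedef n]; ring
  have hsplit' : (fun n : ℕ => conj (c n)) = fun n => conj (b n) + conj (e n) + conj (sh n) := by
    funext n; rw [show c n = b n + e n + sh n from congrFun hsplit n, map_add, map_add]
  -- c vanishes outside `(P″₁η₋, P″₂η₊)`
  have hc_zero : ∀ n : ℕ, ¬ (P1pp D * etaPM D (-1) < n ∧ (n : ℝ) < P2pp D * etaPM D 1) → c n = 0 := by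
    intro n hn
    have h1 : n ∉ ((Finset.Ico 1 ⌈P2pp D * etaPM D 1⌉₊).filter
          (fun n : ℕ => P1pp D * etaPM D (-1) < n ∧ (n : ℝ) < P2pp D * etaPM D 1)) := by
      intro hm; exact hn (Finset.mem_filter.mp hm).2
    have h2 : n ∉ ((Finset.Ico 1 ⌈P2pp D⌉₊).filter (fun n : ℕ => P1pp D < n ∧ (n : ℝ) < P2pp D)) := by
      intro hm
      have h16 := (Finset.mem_filter.mp hm).2
      exact hn ⟨lt_trans (mul_lt_of_lt_one_right hP1pp hη3) h16.1,
        h16.2.trans (lt_mul_of_one_lt_right hP2pp hη4)⟩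
    rw [hcdef n, if_neg h1, if_neg h2, sub_zero]
  -- sizes of the pieces
  set Bb : ℝ := |Cb| * Real.exp (-cb * ell D ^ 10) with hBbdef
  set Be : ℝ := |Ce| * (ell D ^ 19)⁻¹ with hBedef
  have hBb0 : 0 ≤ Bb := by positivity
  have hBe0 : 0 ≤ Be := by positivity
  have hBe1 : Be ≤ 1 := by
    rw [hBedef]
    have h19 : ell D ≤ ell D ^ 19 := by
      calc ell D = ell D ^ 1 := (pow_one _).symm
        _ ≤ ell D ^ 19 := pow_le_pow_right₀ hℓ1 (by norm_num)
    have : |Ce| ≤ ell D ^ 19 := by linarith only [hCeℓ, h19]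
    calc |Ce| * (ell D ^ 19)⁻¹ = |Ce| / ell D ^ 19 := by rw [div_eq_mul_inv]
      _ ≤ 1 := by rw [div_le_one (by positivity)]; exact this
  have hBb1 : Bb ≤ Bstar := by
    rw [hBbdef]
    calc |Cb| * Real.exp (-cb * ell D ^ 10) ≤ |Cb| * 1 := by
          refine mul_le_mul_of_nonneg_left ?_ (abs_nonneg _)
          rw [Real.exp_le_one_iff]
          have : 0 ≤ cb * ell D ^ 10 := by positivity
          linarith
      _ = |Cb| := mul_one _
      _ ≤ Bstar := le_max_right _ _
  have hb_le : ∀ n, ‖b n‖ ≤ Bb := by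
    intro n
    rw [hbdef n]
    split_ifs with hn
    · calc ‖c n‖ ≤ Cb * Real.exp (-cb * ell D ^ 10) := hbulk' n hn.1 hn.2
        _ ≤ |Cb| * Real.exp (-cb * ell D ^ 10) :=
          mul_le_mul_of_nonneg_right (le_abs_self _) (Real.exp_pos _).le
    · rw [norm_zero]; positivity
  have hsh_zero : ∀ n : ℕ, ¬ (P2pp D * etaPM D (-1) ≤ n ∧ (n : ℝ) < P2pp D * etaPM D 1) → sh n = 0 := by
    intro n hn; rw [hshdef n, if_neg hn]
  have hsh_le : ∀ n, ‖sh n‖ ≤ 1 := by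
    intro n
    rcases Nat.eq_zero_or_pos n with rfl | hn
    · have h0 : ¬ (P2pp D * etaPM D (-1) ≤ ((0 : ℕ) : ℝ) ∧ (((0 : ℕ) : ℝ) < P2pp D * etaPM D 1)) := by
        rintro ⟨h, -⟩; push_cast at h; exact absurd h (not_le.mpr (mul_pos hP2pp hη2))
      rw [hsh_zero 0 h0, norm_zero]
      exact zero_le_one
    · have hs := norm_sharp_le χ hD1 hn
      rw [← hshdef n] at hs
      calc ‖sh n‖ ≤ 0.002 / 0.504 * Real.exp (-(ell D ^ 30) * (Real.log (P2pp D / n)) ^ 2) := hs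
        _ ≤ 0.002 / 0.504 * 1 := by
            refine mul_le_mul_of_nonneg_left ?_ (by norm_num)
            rw [Real.exp_le_one_iff]
            exact mul_nonpos_of_nonpos_of_nonneg (neg_nonpos.mpr (pow_pos hℓ 30).le) (sq_nonneg _)
        _ ≤ 1 := by norm_num
  have he_le : ∀ n, ‖e n‖ ≤ Be := by
    intro n
    rw [hedef n, hbdef n]
    split_ifs with hn
    · -- bulk: `e = −s = 0`
      have hs0 : sh n = 0 := hsh_zero n (by rintro ⟨h1, -⟩; linarith [hn.2])
      rw [hs0, sub_self, sub_zero, norm_zero]; positivity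
    · rw [sub_zero]
      calc ‖c n - sh n‖ ≤ Ce * (ell D ^ 19)⁻¹ := hedge'' n
        _ ≤ |Ce| * (ell D ^ 19)⁻¹ := mul_le_mul_of_nonneg_right (le_abs_self _) (by positivity)
  have he_le1 : ∀ n, ‖e n‖ ≤ 1 := fun n => (he_le n).trans hBe1
  -- the four window centres
  set xs : Finset ℝ := {P1pp D * etaPM D (-1 / 2), P1pp D * etaPM D (1 / 2),
    P2pp D * etaPM D (-1 / 2), P2pp D * etaPM D (1 / 2)} with hxs
  have hcard : (xs.card : ℝ) ^ 2 ≤ 16 := by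
    have h4 : xs.card ≤ 4 := by
      rw [hxs]
      refine (Finset.card_insert_le _ _).trans ?_
      refine Nat.succ_le_succ ((Finset.card_insert_le _ _).trans ?_)
      refine Nat.succ_le_succ ((Finset.card_insert_le _ _).trans ?_)
      rw [Finset.card_singleton]
    have : (xs.card : ℝ) ≤ 4 := by exact_mod_cast h4
    calc (xs.card : ℝ) ^ 2 ≤ 4 ^ 2 := pow_le_pow_left₀ (Nat.cast_nonneg _) this 2
      _ = 16 := by norm_num
  have hxs_ok : ∀ x ∈ xs, 0 < x ∧ x ≤ bigP D := by
    -- the largest centre `P″₂η^{½} ≤ P`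
    have htop : P2pp D * etaPM D (1 / 2) ≤ bigP D := by
      have h1 : P2pp D * etaPM D (1 / 2) ≤ Real.exp (0.5 * ell D ^ 9 + 520 * ell D + 1) := by
        have hP2 : P2pp D ≤ Real.exp (0.5 * ell D ^ 9 + 520 * ell D) := by
          rw [P2pp, Sec12D.natCast_eq_exp_ell hD1, bigP, ← Real.exp_mul,
            show 0.5 * ell D ^ 9 + 520 * ell D = (ell D ^ 9 * 0.5 + ell D) + 519 * ell D by ring,
            Real.exp_add, Real.exp_add]
          exact mul_le_mul_of_nonneg_left (Sec12D.t0_le_exp hD1) (by positivity)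
        have hη : etaPM D (1 / 2) ≤ Real.exp 1 := by
          rw [etaPM]
          refine Real.exp_le_exp.mpr ?_
          have : (ell D ^ 10)⁻¹ ≤ 1 := inv_le_one_of_one_le₀ (one_le_pow₀ hℓ1)
          linarith [inv_pos.mpr (pow_pos hℓ 10)]
        rw [Real.exp_add]
        exact mul_le_mul hP2 hη (etaPM_pos D _).le (by positivity)
      refine h1.trans ?_
      rw [bigP, Real.exp_le_exp]
      have h8 : (4 : ℝ) ^ 8 ≤ ell D ^ 8 := pow_le_pow_left₀ (by norm_num) hℓ4 8
      have h9 : ell D * (4 : ℝ) ^ 8 ≤ ell D * ell D ^ 8 := mul_le_mul_of_nonneg_left h8 hℓ.le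
      have e9 : ell D ^ 9 = ell D * ell D ^ 8 := by ring
      rw [e9]
      norm_num at h9 ⊢
      linarith only [h9, hℓ4]
    have hmono : ∀ x : ℝ, 0 < x → x ≤ P2pp D → ∀ a : ℝ, a ≤ 1 / 2 → x * etaPM D a ≤ bigP D := by
      intro x hx0 hx a ha
      calc x * etaPM D a ≤ P2pp D * etaPM D (1 / 2) := by
            refine mul_le_mul hx ?_ (etaPM_pos D a).le hP2pp.le
            rcases eq_or_lt_of_le ha with rfl | ha'
            · exact le_rfl
            · exact (etaPM_lt_etaPM hℓ ha').le
        _ ≤ bigP D := htop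
    have hP12 : P1pp D ≤ P2pp D := by
      rw [hPP]
      have : 1 ≤ bigP D ^ (0.004 : ℝ) := Real.one_le_rpow (one_le_bigP' D) (by norm_num)
      exact le_mul_of_one_le_left hP1pp.le this
    intro x hx
    simp only [hxs, Finset.mem_insert, Finset.mem_singleton] at hx
    rcases hx with rfl | rfl | rfl | rfl
    · exact ⟨mul_pos hP1pp (etaPM_pos D _), hmono _ hP1pp hP12 _ (by norm_num)⟩
    · exact ⟨mul_pos hP1pp (etaPM_pos D _), hmono _ hP1pp hP12 _ le_rfl⟩
    · exact ⟨mul_pos hP2pp (etaPM_pos D _), hmono _ hP2pp le_rfl _ (by norm_num)⟩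
    · exact ⟨mul_pos hP2pp (etaPM_pos D _), hmono _ hP2pp le_rfl _ le_rfl⟩
  -- supports: `e` and `s` live in the windows
  have hmem_of_cover : ∀ {x t : ℝ},
      ((x * etaPM D (-1 / 2) * etaPM D (-1) < t ∧ t < x * etaPM D (-1 / 2) * etaPM D 1) ∨
        (x * etaPM D (1 / 2) * etaPM D (-1) < t ∧ t < x * etaPM D (1 / 2) * etaPM D 1)) →
      x * etaPM D (-1 / 2) ∈ xs → x * etaPM D (1 / 2) ∈ xs →
      ∃ y ∈ xs, y * etaPM D (-1) < t ∧ t < y * etaPM D 1 := by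
    intro x t hcov h1 h2
    rcases hcov with hc | hc
    · exact ⟨_, h1, hc⟩
    · exact ⟨_, h2, hc⟩
  have hx1 : P1pp D * etaPM D (-1 / 2) ∈ xs := by simp [hxs]
  have hx2 : P1pp D * etaPM D (1 / 2) ∈ xs := by simp [hxs]
  have hx3 : P2pp D * etaPM D (-1 / 2) ∈ xs := by simp [hxs]
  have hx4 : P2pp D * etaPM D (1 / 2) ∈ xs := by simp [hxs]
  have hsupp_sh : ∀ n : ℕ, sh n ≠ 0 → ∃ y ∈ xs, y * etaPM D (-1) < n ∧ (n : ℝ) < y * etaPM D 1 := by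
    intro n hn
    by_cases hw : P2pp D * etaPM D (-1) ≤ n ∧ (n : ℝ) < P2pp D * etaPM D 1
    · exact hmem_of_cover (mem_cover_of_edge hℓ hP2pp ⟨hw.1, hw.2.le⟩) hx3 hx4
    · exact absurd (hsh_zero n hw) hn
  have hsupp_e : ∀ n : ℕ, e n ≠ 0 → ∃ y ∈ xs, y * etaPM D (-1) < n ∧ (n : ℝ) < y * etaPM D 1 := by
    intro n hn
    -- not in the bulk, and `c n ≠ 0 ∨ sh n ≠ 0`
    have hnb : ¬ (P1pp D * etaPM D 1 < n ∧ (n : ℝ) < P2pp D * etaPM D (-1)) := by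
      intro hbk
      apply hn
      have hs0 : sh n = 0 := hsh_zero n (by rintro ⟨h1, -⟩; linarith [hbk.2])
      rw [hedef n, hbdef n, if_pos hbk, hs0, sub_self, sub_self]
    by_cases hw : P2pp D * etaPM D (-1) ≤ n ∧ (n : ℝ) < P2pp D * etaPM D 1
    · exact hmem_of_cover (mem_cover_of_edge hℓ hP2pp ⟨hw.1, hw.2.le⟩) hx3 hx4
    · have hs0 : sh n = 0 := hsh_zero n hw
      have hcn : c n ≠ 0 := by
        intro hc0
        apply hn
        rw [hedef n, hbdef n, if_neg hnb, hs0, hc0, sub_self, sub_self]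
      have hrange : P1pp D * etaPM D (-1) < n ∧ (n : ℝ) < P2pp D * etaPM D 1 := by
        by_contra hr; exact hcn (hc_zero n hr)
      -- so `n` is in the `P″₁` edge
      have hlow : (n : ℝ) ≤ P1pp D * etaPM D 1 := by
        by_contra hgt
        push Not at hgt hnb hw
        have h2 : P2pp D * etaPM D (-1) ≤ n := hnb hgt
        exact absurd (hw h2) (not_le.mpr hrange.2)
      exact hmem_of_cover (mem_cover_of_edge hℓ hP1pp ⟨hrange.1.le, hlow⟩) hx1 hx2
  have hsupp_e' : ∀ n : ℕ, conj (e n) ≠ 0 → ∃ y ∈ xs, y * etaPM D (-1) < n ∧ (n : ℝ) < y * etaPM D 1 :=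
    fun n hn => hsupp_e n (fun h => hn (by rw [h, map_zero]))
  have hsupp_sh' : ∀ n : ℕ, conj (sh n) ≠ 0 → ∃ y ∈ xs, y * etaPM D (-1) < n ∧ (n : ℝ) < y * etaPM D 1 :=
    fun n hn => hsupp_sh n (fun h => hn (by rw [h, map_zero]))
  -- norms of conjugates
  have hb_le' : ∀ n, ‖conj (b n)‖ ≤ Bb := fun n => by rw [RCLike.norm_conj]; exact hb_le n
  have hb_leS : ∀ n, ‖b n‖ ≤ Bstar := fun n => (hb_le n).trans hBb1
  have hb_leS' : ∀ n, ‖conj (b n)‖ ≤ Bstar := fun n => (hb_le' n).trans hBb1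
  have he_le' : ∀ n, ‖conj (e n)‖ ≤ Be := fun n => by rw [RCLike.norm_conj]; exact he_le n
  have he_le1' : ∀ n, ‖conj (e n)‖ ≤ 1 := fun n => by rw [RCLike.norm_conj]; exact he_le1 n
  have he_leS : ∀ n, ‖e n‖ ≤ Bstar := fun n => (he_le1 n).trans hBstar1
  have hsh_le' : ∀ n, ‖conj (sh n)‖ ≤ 1 := fun n => by rw [RCLike.norm_conj]; exact hsh_le n
  have hsh_leS : ∀ n, ‖sh n‖ ≤ Bstar := fun n => (hsh_le n).trans hBstar1
  have hsh_leS' : ∀ n, ‖conj (sh n)‖ ≤ Bstar := fun n => (hsh_le' n).trans hBstar1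
  -- the two engines, specialised
  have hTS : ∀ {a₁ a₂ : ℕ → ℂ} {B₁ B₂ : ℝ}, (∀ n, ‖a₁ n‖ ≤ B₁) → (∀ n, ‖a₂ n‖ ≤ B₂) →
      ‖Sj c' D j a₁ a₂‖ ≤ CS * B₁ * B₂ * ell D ^ 27 := by
    intro a₁ a₂ B₁ B₂ h1 h2
    have := XiZeroMajorant.norm_Sj_le_of_bounds hDT j h1 h2
    rw [← hCS] at this
    exact this
  have hWD' : ∀ {a₁ a₂ : ℕ → ℂ} {B₁ B₂ : ℝ}, 0 ≤ B₁ → 0 ≤ B₂ → (∀ n, ‖a₁ n‖ ≤ B₁) → (∀ n, ‖a₂ n‖ ≤ B₂) →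
      (∀ n, a₁ n ≠ 0 → ∃ y ∈ xs, y * etaPM D (-1) < n ∧ (n : ℝ) < y * etaPM D 1) →
      (∀ n, a₂ n ≠ 0 → ∃ y ∈ xs, y * etaPM D (-1) < n ∧ (n : ℝ) < y * etaPM D 1) →
      ‖Sj c' D j a₁ a₂‖ ≤ CW * 16 * B₁ * B₂ * ell D ^ 8 := by
    intro a₁ a₂ B₁ B₂ hB₁ hB₂ h1 h2 hs1 hs2
    have := hWD D hDW j xs hxs_ok B₁ B₂ hB₁ hB₂ a₁ a₂ h1 h2 hs1 hs2
    refine this.trans ?_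
    have h0 : 0 ≤ CW * B₁ * B₂ * ell D ^ 8 := by positivity
    calc CW * (xs.card : ℝ) ^ 2 * B₁ * B₂ * ell D ^ 8 = (xs.card : ℝ) ^ 2 * (CW * B₁ * B₂ * ell D ^ 8) := by
          ring
      _ ≤ 16 * (CW * B₁ * B₂ * ell D ^ 8) := mul_le_mul_of_nonneg_right hcard h0
      _ = CW * 16 * B₁ * B₂ * ell D ^ 8 := by ring
  -- budgets
  set τ : ℝ := ε / 9 * alpha D * a₀ with hτ
  have hτA : τ ≤ ε / 9 * alpha D * frakA χ := by
    rw [hτ]; exact mul_le_mul_of_nonneg_left ha (by positivity)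
  have hbulk_budget : CS * Bstar * Bb * ell D ^ 27 ≤ τ := by
    -- `e^{−cb𝓛¹⁰}·(cb𝓛¹⁰)⁴ ≤ 24`, `𝓛 ≥ M₁`
    have hy : 0 ≤ cb * ell D ^ 10 := by positivity
    have h24 := exp_neg_mul_pow_four_le hy
    have hM₁' : 216 * CS * Bstar * |Cb| ≤ cb ^ 4 * ε * π * a₀ * ell D := by
      have := (div_le_iff₀ (by positivity : 0 < cb ^ 4 * ε * π * a₀)).mp hM₁ℓ
      linarith only [this]
    rw [hBbdef, hτ, hα]
    -- reduce to `CS·B*·|Cb|·e^{−y}·𝓛³⁶ ≤ επa₀/9`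
    rw [show CS * Bstar * (|Cb| * Real.exp (-cb * ell D ^ 10)) * ell D ^ 27 =
        (CS * Bstar * |Cb|) * (Real.exp (-(cb * ell D ^ 10)) * ell D ^ 27) by ring_nf,
      show ε / 9 * (π / ell D ^ 9) * a₀ = (ε * π * a₀ / 9) / ell D ^ 9 by ring]
    rw [le_div_iff₀ (by positivity)]
    have hkey : Real.exp (-(cb * ell D ^ 10)) * ell D ^ 27 * ell D ^ 9 ≤ 24 / (cb ^ 4 * ell D ^ 4) := by
      rw [le_div_iff₀ (by positivity)]
      calc Real.exp (-(cb * ell D ^ 10)) * ell D ^ 27 * ell D ^ 9 * (cb ^ 4 * ell D ^ 4)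
          = Real.exp (-(cb * ell D ^ 10)) * (cb * ell D ^ 10) ^ 4 := by ring
        _ ≤ 24 := h24
    calc CS * Bstar * |Cb| * (Real.exp (-(cb * ell D ^ 10)) * ell D ^ 27) * ell D ^ 9
        = (CS * Bstar * |Cb|) * (Real.exp (-(cb * ell D ^ 10)) * ell D ^ 27 * ell D ^ 9) := by ring
      _ ≤ (CS * Bstar * |Cb|) * (24 / (cb ^ 4 * ell D ^ 4)) := by gcongr
      _ ≤ (CS * Bstar * |Cb|) * (24 / (cb ^ 4 * ell D)) := by
          gcongr
          · calc ell D = ell D ^ 1 := (pow_one _).symm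
              _ ≤ ell D ^ 4 := pow_le_pow_right₀ hℓ1 (by norm_num)
      _ = (216 * CS * Bstar * |Cb|) / (9 * cb ^ 4 * ell D) := by field_simp; ring
      _ ≤ (cb ^ 4 * ε * π * a₀ * ell D) / (9 * cb ^ 4 * ell D) := by gcongr
      _ = ε * π * a₀ / 9 := by field_simp
  have hwin_budget : CW * 16 * Be * ell D ^ 8 ≤ τ := by
    have hM₂' : 144 * CW * |Ce| ≤ ε * π * a₀ * ell D := by
      have := (div_le_iff₀ (by positivity : 0 < ε * π * a₀)).mp hM₂ℓ
      linarith only [this]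
    rw [hBedef, hτ, hα, show CW * 16 * (|Ce| * (ell D ^ 19)⁻¹) * ell D ^ 8 =
      (16 * CW * |Ce|) * ((ell D ^ 19)⁻¹ * ell D ^ 8) by ring,
      show ε / 9 * (π / ell D ^ 9) * a₀ = (ε * π * a₀ / 9) * (ell D ^ 9)⁻¹ by ring]
    have h1 : (ell D ^ 19)⁻¹ * ell D ^ 8 = (ell D ^ 2)⁻¹ * (ell D ^ 9)⁻¹ := by field_simp
    rw [h1, ← mul_assoc]
    refine mul_le_mul_of_nonneg_right ?_ (by positivity)
    rw [← div_eq_mul_inv, div_le_iff₀ (by positivity)]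
    calc 16 * CW * |Ce| ≤ (ε * π * a₀ * ell D) / 9 := by linarith only [hM₂']
      _ ≤ ε * π * a₀ / 9 * ell D ^ 2 := by
          rw [div_mul_eq_mul_div, div_le_div_iff_of_pos_right (by norm_num : (0:ℝ) < 9)]
          have : ell D ≤ ell D ^ 2 := by
            calc ell D = ell D ^ 1 := (pow_one _).symm
              _ ≤ ell D ^ 2 := pow_le_pow_right₀ hℓ1 (by norm_num)
          exact mul_le_mul_of_nonneg_left this (by positivity)
  -- the eight engine bounds (≤ τ each)
  have hT_b : ∀ {v : ℕ → ℂ}, (∀ n, ‖v n‖ ≤ Bstar) → ‖Sj c' D j (fun n => conj (b n)) v‖ ≤ τ := by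
    intro v hv
    calc ‖Sj c' D j (fun n => conj (b n)) v‖ ≤ CS * Bb * Bstar * ell D ^ 27 := hTS hb_le' hv
      _ = CS * Bstar * Bb * ell D ^ 27 := by ring
      _ ≤ τ := hbulk_budget
  have hT_b' : ∀ {u : ℕ → ℂ}, (∀ n, ‖u n‖ ≤ Bstar) → ‖Sj c' D j u b‖ ≤ τ := by
    intro u hu
    calc ‖Sj c' D j u b‖ ≤ CS * Bstar * Bb * ell D ^ 27 := hTS hu hb_le
      _ ≤ τ := hbulk_budget
  have hT_ee : ‖Sj c' D j (fun n => conj (e n)) e‖ ≤ τ := by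
    calc ‖Sj c' D j (fun n => conj (e n)) e‖ ≤ CW * 16 * Be * 1 * ell D ^ 8 :=
          hWD' hBe0 zero_le_one he_le' he_le1 hsupp_e' hsupp_e
      _ = CW * 16 * Be * ell D ^ 8 := by ring
      _ ≤ τ := hwin_budget
  have hT_es : ‖Sj c' D j (fun n => conj (e n)) sh‖ ≤ τ := by
    calc ‖Sj c' D j (fun n => conj (e n)) sh‖ ≤ CW * 16 * Be * 1 * ell D ^ 8 :=
          hWD' hBe0 zero_le_one he_le' hsh_le hsupp_e' hsupp_sh
      _ = CW * 16 * Be * ell D ^ 8 := by ring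
      _ ≤ τ := hwin_budget
  have hT_se : ‖Sj c' D j (fun n => conj (sh n)) e‖ ≤ τ := by
    calc ‖Sj c' D j (fun n => conj (sh n)) e‖ ≤ CW * 16 * 1 * Be * ell D ^ 8 :=
          hWD' zero_le_one hBe0 hsh_le' he_le hsupp_sh' hsupp_e
      _ = CW * 16 * Be * ell D ^ 8 := by ring
      _ ≤ τ := hwin_budget
  have hT_ss : ‖Sj c' D j (fun n => conj (sh n)) sh‖ ≤ ε / 9 * alpha D * frakA χ := hcore' hAss j hj
  -- assemble
  rw [hsplit', hsplit, Sj_add₃]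
  have hτA' : τ ≤ ε / 9 * alpha D * frakA χ := hτA
  calc _ ≤ (‖Sj c' D j (fun n => conj (b n)) b‖ + ‖Sj c' D j (fun n => conj (b n)) e‖ +
            ‖Sj c' D j (fun n => conj (b n)) sh‖) +
          (‖Sj c' D j (fun n => conj (e n)) b‖ + ‖Sj c' D j (fun n => conj (e n)) e‖ +
            ‖Sj c' D j (fun n => conj (e n)) sh‖) +
          (‖Sj c' D j (fun n => conj (sh n)) b‖ + ‖Sj c' D j (fun n => conj (sh n)) e‖ +
            ‖Sj c' D j (fun n => conj (sh n)) sh‖) := by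
        refine (norm_add₃_le).trans (add_le_add (add_le_add norm_add₃_le norm_add₃_le) norm_add₃_le)
    _ ≤ (τ + τ + τ) + (τ + τ + τ) + (τ + τ + ε / 9 * alpha D * frakA χ) :=
        add_le_add (add_le_add
          (add_le_add (add_le_add (hT_b hb_leS) (hT_b he_leS)) (hT_b hsh_leS))
          (add_le_add (add_le_add (hT_b' (fun n => (he_le1' n).trans hBstar1)) hT_ee) hT_es))
          (add_le_add (add_le_add (hT_b' hsh_leS') hT_se) hT_ss)
    _ ≤ 8 * (ε / 9 * alpha D * frakA χ) + ε / 9 * alpha D * frakA χ := by linarith only [hτA']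
    _ = ε * alpha D * frakA χ := by ring

/-- **(12.8) from the sharp core alone** (given Prop. 2.2 (i), Lemma 2.3, Lemma 8.1, Prop. 7.1, all in
scope in the skeleton): `eq128_of_sjDual_small` (tree) ∘ `sjDual_small_of_sharpCore`. So the binder
`Eq128` of the skeleton rests on ONE estimate: `S_j(𝐬̄,𝐬) = o(α𝔞)` for the Gaussian window of
logarithmic width `𝓛⁻¹⁵` at `P″₂`. [cite: Zhang2022LandauSiegel, §12 (12.8) p.67] -/
theorem eq128_of_sharpCore (c' : ℝ) (h22 : Prop22i) (h23 : Lemma23 c') (h81 : Lemma81 c')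
    (h71 : Prop71 c')
    (hcore : ∀ ε : ℝ, 0 < ε → ForAllLarge fun D _ χ => AssumptionA D χ →
      ∀ j ∈ ({1, 2, 3} : Finset ℕ),
        ‖Sj c' D j (fun n : ℕ => conj (if P2pp D * etaPM D (-1) ≤ n ∧ (n : ℝ) < P2pp D * etaPM D 1 then
          ((0.004 / 0.504 : ℝ) : ℂ) * χ (n : ZMod D) * (((n : ℝ) / P1pp D : ℝ) : ℂ) ^ beta6 D *
            ((gW D (P2pp D / n) - (if (n : ℝ) < P2pp D then 1 else 0) : ℝ) : ℂ)
        else 0)) (fun n : ℕ => (if P2pp D * etaPM D (-1) ≤ n ∧ (n : ℝ) < P2pp D * etaPM D 1 then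
          ((0.004 / 0.504 : ℝ) : ℂ) * χ (n : ZMod D) * (((n : ℝ) / P1pp D : ℝ) : ℂ) ^ beta6 D *
            ((gW D (P2pp D / n) - (if (n : ℝ) < P2pp D then 1 else 0) : ℝ) : ℂ)
        else 0))‖ ≤ ε * alpha D * frakA χ) :
    Eq128 c' :=
  eq128_of_sjDual_small c' h22 h23 h81 h71 (sjDual_small_of_sharpCore c' hcore)

end Reduction

end Literature.NumberTheory.LFunctions.Zhang2022.Typed.Sec12A
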